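import Summits.Ventures.HodgeRepro2.T5SU11ResolventNeumannOrigin

/-!
# The decaying solution at the origin: `sinh 2t · χ_λ′(t) → −1` and `sinh 2t · χ_λ(t) → 0` as `t → 0⁺`

The flux normalisation of the Green's function at the singular endpoint: with `χ_λ′ = J φ_λ′ − φ_λ′ I − 1/(sinh 2t φ_λ)`
(rows 443/447), `φ_λ′(t) → 0`, `|I(t)| ≤ (−log t)/(2m)` (row 626) and `φ_λ(a_0) = 1`,

* `tendsto_sinh_mul_sphDecay'_nhdsGT_zero` — **`sinh 2t · χ_λ′(t) → −1`** as `t → 0⁺` (the flux of the decaying solution at the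
  origin is `−1`: the Wronskian normalisation `sinh 2t (φ_λ χ_λ′ − χ_λ φ_λ′) = −1` read at the endpoint);
* `tendsto_sinh_mul_sphDecay_nhdsGT_zero` — **`sinh 2t · χ_λ(t) → 0`** (`χ_λ = O(log(1/t))`);
* `tendsto_sinh_mul_sphDecay_mul_deriv_sph_nhdsGT_zero` — `sinh 2t · χ_λ(t) φ_λ′(t) → 0`;
* `tendsto_wronskian_nhdsGT_zero` — **`sinh 2t (φ_λ χ_λ′ − χ_λ φ_λ′)(t) → −1`** as `t → 0⁺`.

Nothing is claimed about (N).

Blind lane: Mathlib + the HodgeRepro2 prefix only; no sorry; axioms ⊆ {propext, Classical.choice,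
Quot.sound}.
-/

namespace Summit.Ventures.HodgeRepro2.T5SU11SphericalDecayOriginFlux

open Filter Topology MeasureTheory
open Set (Ioi Ioc Icc)
open T5SU11Cartan T5SU11SphericalFunction T5SU11SphericalBounds T5SU11SphericalContinuous T5SU11SphericalDecay
  T5SU11SphericalSolutionSpaceAll T5SU11SphericalDeriv T5SU11ReductionOfOrder T5SU11ReductionOfOrderInfinity
  T5SU11RadialGreenImproperOrigin T5SU11ResolventNeumannOrigin

/-- `sinh 2t → 0` as `t → 0⁺`. -/
theorem tendsto_sinh_two_mul_nhdsGT_zero : Tendsto (fun t : ℝ => Real.sinh (2 * t)) (𝓝[>] 0) (𝓝 0) := by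
  have h : Tendsto (fun t : ℝ => Real.sinh (2 * t)) (𝓝 0) (𝓝 (Real.sinh (2 * 0))) :=
    (Real.continuous_sinh.comp (continuous_const.mul continuous_id)).tendsto 0
  simpa using h.mono_left nhdsWithin_le_nhds

/-- `sinh 2t · (−log t) → 0` as `t → 0⁺` (`sinh 2t ≤ 2t cosh 2` on `(0, 1]`, `t log t → 0`). -/
theorem tendsto_sinh_two_mul_mul_neg_log_nhdsGT_zero :
    Tendsto (fun t : ℝ => Real.sinh (2 * t) * (-Real.log t)) (𝓝[>] 0) (𝓝 0) := by
  have h2 : Tendsto (fun t : ℝ => Real.log t * t) (𝓝[>] 0) (𝓝 0) := by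
    have := tendsto_log_mul_rpow_nhdsGT_zero one_pos
    simpa only [Real.rpow_one] using this
  have hlim : Tendsto (fun t : ℝ => 2 * Real.cosh 2 * (-(Real.log t * t))) (𝓝[>] 0) (𝓝 0) := by
    simpa using h2.neg.const_mul (2 * Real.cosh 2)
  refine squeeze_zero_norm' ?_ hlim
  filter_upwards [Ioo_mem_nhdsGT one_pos] with t ht
  have hlog : 0 ≤ -Real.log t := neg_nonneg.mpr (Real.log_nonpos ht.1.le ht.2.le)
  have hs : 0 ≤ Real.sinh (2 * t) := (T5SU11ReductionOfOrder.sinh_two_mul_pos ht.1).le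
  rw [Real.norm_eq_abs, abs_of_nonneg (mul_nonneg hs hlog)]
  have h := T5SU11ReductionOfOrderOrigin.sinh_two_mul_le_of_le_one ht.1.le ht.2.le
  calc Real.sinh (2 * t) * (-Real.log t) ≤ 2 * t * Real.cosh 2 * (-Real.log t) :=
        mul_le_mul_of_nonneg_right h hlog
    _ = 2 * Real.cosh 2 * (-(Real.log t * t)) := by ring

section measure

variable [MeasurableSpace Circle] [BorelSpace Circle]

variable {lam : ℝ} (hlam : 1 < lam)

include hlam in
/-- **`sinh 2t · χ_λ(t) → 0` as `t → 0⁺`** (`χ_λ ≤ Φ (T_λ(1) + (−log t)/(2m))` on `(0, 1]`, row 493). -/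
theorem tendsto_sinh_mul_sphDecay_nhdsGT_zero :
    Tendsto (fun t => Real.sinh (2 * t) * sphDecay lam t) (𝓝[>] 0) (𝓝 0) := by
  obtain ⟨m, hm, hmin⟩ := exists_sph_hyp_sq_ge lam
  obtain ⟨Φ, hΦ, hΦle⟩ := exists_sph_hyp_le lam
  set T1 := tailIntegral (fun t => sph lam (hyp t)) 1 with hT1
  have hT1pos : 0 < T1 :=
    tailIntegral_pos (hφ_sph lam) (hpos_sph lam) (integrableOn_roIntegrand_sph hlam) one_pos
  have hlim : Tendsto (fun t => Φ * T1 * Real.sinh (2 * t) + Φ / (2 * m) * (Real.sinh (2 * t) * (-Real.log t)))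
      (𝓝[>] 0) (𝓝 0) := by
    have := (tendsto_sinh_two_mul_nhdsGT_zero.const_mul (Φ * T1)).add
      (tendsto_sinh_two_mul_mul_neg_log_nhdsGT_zero.const_mul (Φ / (2 * m)))
    simpa using this
  refine squeeze_zero_norm' ?_ hlim
  filter_upwards [Ioo_mem_nhdsGT one_pos] with t ht
  have hT := tailIntegral_le_of_le_one hlam hm hmin ht.1 ht.2.le
  have hTpos : 0 < tailIntegral (fun t => sph lam (hyp t)) t :=
    tailIntegral_pos (hφ_sph lam) (hpos_sph lam) (integrableOn_roIntegrand_sph hlam) ht.1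
  have hlog : 0 ≤ -Real.log t := neg_nonneg.mpr (Real.log_nonpos ht.1.le ht.2.le)
  have hs : 0 ≤ Real.sinh (2 * t) := (T5SU11ReductionOfOrder.sinh_two_mul_pos ht.1).le
  have hχle : sphDecay lam t ≤ Φ * (T1 + (-Real.log t) / (2 * m)) := by
    show sph lam (hyp t) * tailIntegral (fun t => sph lam (hyp t)) t ≤ _
    exact mul_le_mul (hΦle t ⟨ht.1.le, ht.2.le⟩) hT hTpos.le hΦ.le
  rw [Real.norm_eq_abs, abs_of_nonneg (mul_nonneg hs (sphDecay_pos hlam ht.1).le)]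
  calc Real.sinh (2 * t) * sphDecay lam t ≤ Real.sinh (2 * t) * (Φ * (T1 + (-Real.log t) / (2 * m))) :=
        mul_le_mul_of_nonneg_left hχle hs
    _ = Φ * T1 * Real.sinh (2 * t) + Φ / (2 * m) * (Real.sinh (2 * t) * (-Real.log t)) := by
        field_simp

include hlam in
/-- **THE FLUX OF THE DECAYING SOLUTION AT THE ORIGIN**: `sinh 2t · χ_λ′(t) → −1` as `t → 0⁺`. -/
theorem tendsto_sinh_mul_sphDecay'_nhdsGT_zero :
    Tendsto (fun t => Real.sinh (2 * t) * sphDecay' lam t) (𝓝[>] 0) (𝓝 (-1)) := by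
  obtain ⟨m, hm, hmin⟩ := exists_sph_hyp_sq_ge lam
  set J := ∫ s in Ioi 1, roIntegrand (fun t => sph lam (hyp t)) s with hJ
  have hφ' := tendsto_deriv_sph_hyp_nhdsGT_zero lam
  -- `sinh 2t · χ′ = J sinh 2t φ′ − φ′ · (sinh 2t · I) − 1/φ`
  have hφ : Tendsto (fun t => sph lam (hyp t)) (𝓝[>] 0) (𝓝 1) := by
    have h : Tendsto (fun t => sph lam (hyp t)) (𝓝[>] 0) (𝓝 (sph lam (hyp 0))) :=
      ((continuous_sph_hyp lam).tendsto 0).mono_left (nhdsWithin_le_nhds (s := Ioi 0))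
    rwa [T5SU11OneParameter.hyp_zero, sph_one] at h
  have hinv : Tendsto (fun t => (sph lam (hyp t))⁻¹) (𝓝[>] 0) (𝓝 1) := by
    have := hφ.inv₀ one_ne_zero
    simpa using this
  -- `sinh 2t · I(t) → 0`
  have hsI : Tendsto (fun t => Real.sinh (2 * t) * roIntegral (fun t => sph lam (hyp t)) t) (𝓝[>] 0) (𝓝 0) := by
    have hlim : Tendsto (fun t : ℝ => 1 / (2 * m) * (Real.sinh (2 * t) * (-Real.log t))) (𝓝[>] 0) (𝓝 0) := by
      simpa using tendsto_sinh_two_mul_mul_neg_log_nhdsGT_zero.const_mul (1 / (2 * m))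
    refine squeeze_zero_norm' ?_ hlim
    filter_upwards [Ioo_mem_nhdsGT one_pos] with t ht
    have hIle := abs_roIntegral_le_of_le_one hlam hm hmin ht.1 ht.2.le
    have hs : 0 ≤ Real.sinh (2 * t) := (T5SU11ReductionOfOrder.sinh_two_mul_pos ht.1).le
    rw [Real.norm_eq_abs, abs_mul, abs_of_nonneg hs]
    calc Real.sinh (2 * t) * |roIntegral (fun t => sph lam (hyp t)) t|
        ≤ Real.sinh (2 * t) * ((-Real.log t) / (2 * m)) := mul_le_mul_of_nonneg_left hIle hs
      _ = 1 / (2 * m) * (Real.sinh (2 * t) * (-Real.log t)) := by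
          field_simp
  have h := ((tendsto_sinh_two_mul_nhdsGT_zero.mul hφ').const_mul J).sub ((hφ'.mul hsI).add hinv)
  simp only [mul_zero, zero_add, zero_sub] at h
  refine h.congr' ?_
  filter_upwards [self_mem_nhdsWithin] with t ht
  have hφpos : 0 < sph lam (hyp t) := sph_hyp_pos lam t
  have hsp : Real.sinh (2 * t) ≠ 0 := (T5SU11ReductionOfOrder.sinh_two_mul_pos ht).ne'
  have hχ' : sphDecay' lam t = J * deriv (fun t => sph lam (hyp t)) t
      - (deriv (fun t => sph lam (hyp t)) t * roIntegral (fun t => sph lam (hyp t)) t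
        + (Real.sinh (2 * t) * sph lam (hyp t))⁻¹) := rfl
  rw [hχ']
  field_simp

include hlam in
/-- `sinh 2t · χ_λ(t) φ_λ′(t) → 0` as `t → 0⁺`. -/
theorem tendsto_sinh_mul_sphDecay_mul_deriv_sph_nhdsGT_zero :
    Tendsto (fun t => Real.sinh (2 * t) * sphDecay lam t * deriv (fun t => sph lam (hyp t)) t) (𝓝[>] 0) (𝓝 0) := by
  have := (tendsto_sinh_mul_sphDecay_nhdsGT_zero hlam).mul (tendsto_deriv_sph_hyp_nhdsGT_zero lam)
  simpa using this

include hlam in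
/-- **The Wronskian normalisation read at the origin**: `sinh 2t (φ_λ χ_λ′ − χ_λ φ_λ′)(t) → −1` as `t → 0⁺`. -/
theorem tendsto_wronskian_nhdsGT_zero :
    Tendsto (fun t => Real.sinh (2 * t) * (sph lam (hyp t) * sphDecay' lam t
      - sphDecay lam t * deriv (fun t => sph lam (hyp t)) t)) (𝓝[>] 0) (𝓝 (-1)) := by
  have hφ : Tendsto (fun t => sph lam (hyp t)) (𝓝[>] 0) (𝓝 1) := by
    have h : Tendsto (fun t => sph lam (hyp t)) (𝓝[>] 0) (𝓝 (sph lam (hyp 0))) :=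
      ((continuous_sph_hyp lam).tendsto 0).mono_left (nhdsWithin_le_nhds (s := Ioi 0))
    rwa [T5SU11OneParameter.hyp_zero, sph_one] at h
  have h := (hφ.mul (tendsto_sinh_mul_sphDecay'_nhdsGT_zero hlam)).sub
    (tendsto_sinh_mul_sphDecay_mul_deriv_sph_nhdsGT_zero hlam)
  simp only [one_mul, sub_zero] at h
  refine h.congr' (Eventually.of_forall fun t => ?_)
  ring

end measure

end Summit.Ventures.HodgeRepro2.T5SU11SphericalDecayOriginFlux
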